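import Mathlib
import HarnessLib
import Summits.Ventures.LatticeQCDFlow.Exactness.NCMCGeneralSpaceErgodicRunCrooks
import Summits.Ventures.LatticeQCDFlow.Exactness.NCMCGeneralSpaceStationaryRun
import Summits.Ventures.LatticeQCDFlow.Scoring.ChainPathLaw

/-!
# Correlated starts, the Markov instance: the engine's restart chain of evolution records is a stationary Markov chain with invariant law `P_F`

HONEST FRAMING: exact (Metropolis-corrected) sampling algorithms for lattice gauge theory;
figures of merit are autocorrelation/cost numbers at stated couplings and volumes; no
continuum-physics claim.

Venture `LatticeQCDFlow` (cell pub-lqcd), topic `Exactness`; FANOUT row 13 (`eng-snf`, GEN-16).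
NEW WORK of the cell, not a published result; no definition is introduced; nothing is cited as a
fact (Birkhoff's theorem enters through `NCMCGeneralSpaceErgodicRun.lean` as a tree-proved fact).
The chain law is row 8's object: Mathlib's Ionescu-Tulcea measure
`P_{μ₀,κ} = Kernel.trajMeasure μ₀ (n ↦ κ ∘ (h ↦ h n))` of the homogeneous Markov chain with kernel `κ`
(`Scoring/ChainTimeAverage.lean`, `Scoring/ChainPathLaw.lean`: `chain_marginal`, `chain_map_shift`).

## The model of the engine (`latflow-snf`, Jarzynski / reweighting lane with restarts)

A level sampler `K : Kernel Ω Ω` (the `n_between` sweeps at the prior level) leaves the prior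
weight invariant, `ν₀ ∘ K = ν₀`; at every launch a forward evolution `ε ~ κF(x, ·)` is recorded from
the current state `x`, and the level chain continues from `x` (the evolution is a side branch).
Because a record remembers its start, `s ε = x` a.s. (`CrooksPair.start_ae`), the RECORD STREAM IS
ITSELF A MARKOV CHAIN on `E` with kernel `ε ↦ (κF ∘ₖ K)(s ε)` — written `(κF ∘ₖ K).comap s` — and
(this file) invariant law `P_F = fwdPathLaw ν₀ κF`.

## Content

* §1 (any Markov chain `κ` on `S` started in an invariant probability law `π`):
  **`chain_map_eval_of_invariant`** — every one-time marginal of `P_{π,κ}` is `π`;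
  **`measurePreserving_shift_chain`** — `P_{π,κ}` is STATIONARY for the shift (row 8's path-level
  Markov property `chain_map_shift` at `s = 1` plus the marginal).
* §2 (the restart kernel): `comp_comap_start_eq` — `((κF ∘ₖ K).comap s) ∘ₖ κF = κF ∘ₖ K` (the
  record forgets everything but its start); **`invariant_restartKernel`** — if `K ∘ₘ π = π` then
  `π ∘ₘ κF` is invariant for the restart kernel; **`CrooksPair.invariant_restartKernel`** — for a
  Crooks pair and a `ν₀`-invariant level sampler, `P_F` is invariant for the restart kernel of its
  forward records (`fwdPathLaw_eq_bind_smul`: `P_F = κF ∘ₘ (Z₀⁻¹ • ν₀)`).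
* §3 (consequences, value-free): **`CrooksPair.measurePreserving_shift_restartChain`** — the
  engine's record stream started in equilibrium is stationary with one-record marginal `P_F`
  (`CrooksPair.restartChain_map_eval`), hence (`NCMCGeneralSpaceStationaryRun`)
  **`CrooksPair.integral_sampleMean_exp_neg_work_restartChain`** — JARZYNSKI'S IDENTITY HOLDS FOR THE
  RESTART CHAIN at every `n ≥ 1` whatever `n_between` is (even `K = id`, no decorrelation at all);
  and (`NCMCGeneralSpaceErgodicRunCrooks`) **`CrooksPair.tendsto_jarzynskiEstimate_ae_restartChain`**
  — IF the record chain is ergodic for the shift, `ΔF̂_n → ΔF` almost surely along it.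

NOT CLAIMED: ergodicity of the restart chain for any concrete level sampler (it is the hypothesis
`hErg`; sufficient conditions — `π`-irreducibility of `K`, a Doeblin minorisation — are not typed
here); the NCMC (Metropolised, two-level) lane; reverse-leg / two-chain statements; error bars.
-/

namespace Summit.Ventures.LatticeQCDFlow.Exactness.GeneralNCMC

open MeasureTheory ProbabilityTheory Set Filter Finset
open scoped ENNReal Topology

/-! ## §1 A Markov chain started in an invariant law is a stationary stream -/

section Chain

variable {S : Type*} [MeasurableSpace S] (κ : Kernel S S) [IsMarkovKernel κ]
variable {π : Measure S} [IsProbabilityMeasure π]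

/-- **Every one-time marginal of the chain started in an invariant law is that law**
(measure form of row 8's `Scoring.chain_marginal`). -/
theorem chain_map_eval_of_invariant (hπ : Kernel.Invariant κ π) (i : ℕ) :
    (Kernel.trajMeasure (X := fun _ : ℕ => S) π
        (fun n : ℕ => κ.comap (fun h : (j : ↥(Finset.Iic n)) → S => h ⟨n, Finset.mem_Iic.2 le_rfl⟩)
          (measurable_pi_apply _))).map (fun x : ℕ → S => x i) = π := by
  ext B hB
  rw [← measureReal_eq_measureReal_iff (measure_ne_top _ _) (measure_ne_top _ _),
    map_measureReal_apply (measurable_pi_apply i) hB,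
    ← integral_indicator_one ((measurable_pi_apply i) hB), ← integral_indicator_one hB]
  exact Scoring.chain_marginal hπ i (f := B.indicator 1) (measurable_one.indicator hB) (C := 1)
    (fun x => by
      by_cases hx : x ∈ B
      · simp [Set.indicator_of_mem hx]
      · simp [Set.indicator_of_notMem hx])

/-- **A Markov chain started in an invariant probability law is STATIONARY**: the shift preserves
its path law. -/
theorem measurePreserving_shift_chain (hπ : Kernel.Invariant κ π) :
    MeasurePreserving (fun (x : ℕ → S) (k : ℕ) => x (k + 1))
      (Kernel.trajMeasure (X := fun _ : ℕ => S) π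
        (fun n : ℕ => κ.comap (fun h : (j : ↥(Finset.Iic n)) → S => h ⟨n, Finset.mem_Iic.2 le_rfl⟩)
          (measurable_pi_apply _)))
      (Kernel.trajMeasure (X := fun _ : ℕ => S) π
        (fun n : ℕ => κ.comap (fun h : (j : ↥(Finset.Iic n)) → S => h ⟨n, Finset.mem_Iic.2 le_rfl⟩)
          (measurable_pi_apply _))) := by
  refine ⟨measurable_shift, ?_⟩
  have h1 := Scoring.chain_map_shift κ π 1
  rw [chain_map_eval_of_invariant κ hπ 1] at h1
  have hfun : (fun (x : ℕ → S) (k : ℕ) => x (k + 1)) = fun (x : ℕ → S) (n : ℕ) => x (1 + n) := by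
    funext x n
    rw [Nat.add_comm]
  rw [hfun, h1]

/-- Hence every file about stationary streams applies to it; for instance the time average of a
`π`-integrable observable along the chain is unbiased at every `n ≥ 1`. -/
theorem integral_sum_div_chain (hπ : Kernel.Invariant κ π) {φ : S → ℝ} (hφ : Integrable φ π)
    {n : ℕ} (hn : n ≠ 0) :
    ∫ x, (∑ i ∈ range n, φ (x i)) / n ∂(Kernel.trajMeasure (X := fun _ : ℕ => S) π
        (fun n : ℕ => κ.comap (fun h : (j : ↥(Finset.Iic n)) → S => h ⟨n, Finset.mem_Iic.2 le_rfl⟩)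
          (measurable_pi_apply _))) = ∫ a, φ a ∂π :=
  integral_sum_div_of_stationary (measurePreserving_shift_chain κ hπ)
    (chain_map_eval_of_invariant κ hπ 0) hφ hn

/-- And every file about ergodic streams applies under the one extra hypothesis that the chain is
ergodic for the shift: then time averages of `π`-integrable observables converge almost surely. -/
theorem tendsto_sum_div_ae_chain
    (hErg : Ergodic (fun (x : ℕ → S) (k : ℕ) => x (k + 1))
      (Kernel.trajMeasure (X := fun _ : ℕ => S) π
        (fun n : ℕ => κ.comap (fun h : (j : ↥(Finset.Iic n)) → S => h ⟨n, Finset.mem_Iic.2 le_rfl⟩)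
          (measurable_pi_apply _))))
    (hπ : Kernel.Invariant κ π) {φ : S → ℝ} (hφ : Integrable φ π) :
    ∀ᵐ x ∂(Kernel.trajMeasure (X := fun _ : ℕ => S) π
        (fun n : ℕ => κ.comap (fun h : (j : ↥(Finset.Iic n)) → S => h ⟨n, Finset.mem_Iic.2 le_rfl⟩)
          (measurable_pi_apply _))),
      Tendsto (fun n : ℕ => (∑ i ∈ range n, φ (x i)) / n) atTop (𝓝 (∫ a, φ a ∂π)) :=
  tendsto_sum_div_ae_of_ergodic hErg (chain_map_eval_of_invariant κ hπ 0) hφ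

end Chain

/-! ## §2 The restart kernel of a record-producing sampler and its invariant law -/

section Restart

variable {Ω E : Type*} [MeasurableSpace Ω] [MeasurableSpace E]
variable (K : Kernel Ω Ω) [IsMarkovKernel K] (κF : Kernel Ω E) [IsMarkovKernel κF]
variable {s : E → Ω}

/-- A record that remembers its start: integrating a function of the start against `κF(x, ·)` is
evaluating it at `x`. -/
theorem bind_comp_start_eq (hstart : ∀ x, ∀ᵐ ε ∂(κF x), s ε = x)
    (η : Kernel Ω E) [IsMarkovKernel η] (x : Ω) :
    (κF x).bind (fun ε => η (s ε)) = η x := by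
  rw [Measure.bind_congr_right ((hstart x).mono fun ε hε => by rw [hε]), Measure.bind_const,
    measure_univ, one_smul]

/-- **The record forgets everything but its start**: `((η).comap s) ∘ₖ κF = η` for every Markov
kernel `η` out of the start; in particular `((κF ∘ₖ K).comap s) ∘ₖ κF = κF ∘ₖ K`. -/
theorem comp_comap_start_eq (hs : Measurable s) (hstart : ∀ x, ∀ᵐ ε ∂(κF x), s ε = x)
    (η : Kernel Ω E) [IsMarkovKernel η] : (η.comap s hs) ∘ₖ κF = η := by
  ext x : 1
  rw [Kernel.comp_apply]
  exact bind_comp_start_eq κF hstart η x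

/-- **The invariant law of the restart kernel.**  If the level sampler leaves `π` invariant
(`K ∘ₘ π = π`), the law `κF ∘ₘ π` of one record from equilibrium is invariant for the restart
kernel `ε ↦ (κF ∘ₖ K)(s ε)`. -/
theorem invariant_restartKernel (hs : Measurable s) (hstart : ∀ x, ∀ᵐ ε ∂(κF x), s ε = x)
    {π : Measure Ω} (hπ : Kernel.Invariant K π) :
    Kernel.Invariant ((κF ∘ₖ K).comap s hs) (π.bind κF) := by
  unfold Kernel.Invariant
  rw [Measure.comp_assoc, comp_comap_start_eq κF hs hstart (κF ∘ₖ K), ← Measure.comp_assoc, hπ.def]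

omit [IsMarkovKernel K] in
/-- Invariance survives normalisation of the weight. -/
theorem invariant_smul {ν : Measure Ω} (hν : Kernel.Invariant K ν) (c : ℝ≥0∞) :
    Kernel.Invariant K (c • ν) := by
  unfold Kernel.Invariant at hν ⊢
  rw [Measure.bind_smul, hν]

end Restart

/-! ## §3 Crooks pairs: the engine's restart chain of forward records -/

namespace CrooksPair

variable {Ω E : Type*} [MeasurableSpace Ω] [MeasurableSpace E]
variable {ν₀ ν₁ : Measure Ω} {κF κR : Kernel Ω E} {s e : E → Ω} {W : E → ℝ}

/-- `P_F = κF ∘ₘ (Z₀⁻¹ • ν₀)`: the equilibrium path law is one record out of the normalised prior. -/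
theorem fwdPathLaw_eq_bind_smul (ν₀ : Measure Ω) (κF : Kernel Ω E) :
    fwdPathLaw ν₀ κF = ((ν₀ univ)⁻¹ • ν₀).bind κF := by
  rw [fwdPathLaw, Measure.bind_smul]

/-- **`P_F` is invariant for the restart kernel of the forward records** of a Crooks pair whose
prior-level sampler `K` leaves the prior weight `ν₀` invariant. -/
theorem invariant_restartKernel (K : Kernel Ω Ω) [IsMarkovKernel K] [IsMarkovKernel κF]
    (hK : Kernel.Invariant K ν₀) (h : CrooksPair ν₀ ν₁ κF κR s e W) :
    Kernel.Invariant ((κF ∘ₖ K).comap s h.measurable_s) (fwdPathLaw ν₀ κF) := by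
  rw [fwdPathLaw_eq_bind_smul]
  exact GeneralNCMC.invariant_restartKernel K κF h.measurable_s h.start_ae
    (invariant_smul K hK _)

/-- **The engine's restart chain of forward records, started in equilibrium, has one-record
marginal `P_F` at every index.** -/
theorem restartChain_map_eval (K : Kernel Ω Ω) [IsMarkovKernel K] [IsFiniteMeasure ν₀]
    [IsMarkovKernel κF] (h0 : ν₀ univ ≠ 0) (hK : Kernel.Invariant K ν₀)
    (h : CrooksPair ν₀ ν₁ κF κR s e W) (i : ℕ) :
    haveI := isProbabilityMeasure_fwdPathLaw ν₀ h0 κF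
    (Kernel.trajMeasure (X := fun _ : ℕ => E) (fwdPathLaw ν₀ κF)
        (fun n : ℕ => ((κF ∘ₖ K).comap s h.measurable_s).comap
          (fun hh : (j : ↥(Finset.Iic n)) → E => hh ⟨n, Finset.mem_Iic.2 le_rfl⟩)
          (measurable_pi_apply _))).map (fun x : ℕ → E => x i) = fwdPathLaw ν₀ κF := by
  haveI := isProbabilityMeasure_fwdPathLaw ν₀ h0 κF
  exact chain_map_eval_of_invariant _ (h.invariant_restartKernel K hK) i

/-- **The engine's restart chain of forward records, started in equilibrium, is STATIONARY.** -/
theorem measurePreserving_shift_restartChain (K : Kernel Ω Ω) [IsMarkovKernel K]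
    [IsFiniteMeasure ν₀] [IsMarkovKernel κF] (h0 : ν₀ univ ≠ 0) (hK : Kernel.Invariant K ν₀)
    (h : CrooksPair ν₀ ν₁ κF κR s e W) :
    haveI := isProbabilityMeasure_fwdPathLaw ν₀ h0 κF
    MeasurePreserving (fun (x : ℕ → E) (k : ℕ) => x (k + 1))
      (Kernel.trajMeasure (X := fun _ : ℕ => E) (fwdPathLaw ν₀ κF)
        (fun n : ℕ => ((κF ∘ₖ K).comap s h.measurable_s).comap
          (fun hh : (j : ↥(Finset.Iic n)) → E => hh ⟨n, Finset.mem_Iic.2 le_rfl⟩)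
          (measurable_pi_apply _)))
      (Kernel.trajMeasure (X := fun _ : ℕ => E) (fwdPathLaw ν₀ κF)
        (fun n : ℕ => ((κF ∘ₖ K).comap s h.measurable_s).comap
          (fun hh : (j : ↥(Finset.Iic n)) → E => hh ⟨n, Finset.mem_Iic.2 le_rfl⟩)
          (measurable_pi_apply _))) := by
  haveI := isProbabilityMeasure_fwdPathLaw ν₀ h0 κF
  exact measurePreserving_shift_chain _ (h.invariant_restartKernel K hK)

/-- **JARZYNSKI'S IDENTITY FOR THE RESTART CHAIN.**  For every Crooks pair, every `ν₀`-invariant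
level sampler `K` between launches (any `n_between`, even none: `K = Kernel.id` is allowed) and
every `n ≥ 1`: along the equilibrium restart chain of forward records,
`E[(1/n) Σ_{i<n} e^{−W_i}] = Z₁/Z₀ = e^{−ΔF}`. -/
theorem integral_sampleMean_exp_neg_work_restartChain (K : Kernel Ω Ω) [IsMarkovKernel K]
    [IsFiniteMeasure ν₀] [IsFiniteMeasure ν₁] [IsMarkovKernel κF] [IsMarkovKernel κR]
    (h0 : ν₀ univ ≠ 0) (hK : Kernel.Invariant K ν₀) (h : CrooksPair ν₀ ν₁ κF κR s e W) {n : ℕ}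
    (hn : n ≠ 0) :
    haveI := isProbabilityMeasure_fwdPathLaw ν₀ h0 κF
    ∫ x, sampleMean (fun ε => Real.exp (-W ε)) (fun i : Fin n => x i)
      ∂(Kernel.trajMeasure (X := fun _ : ℕ => E) (fwdPathLaw ν₀ κF)
        (fun n : ℕ => ((κF ∘ₖ K).comap s h.measurable_s).comap
          (fun hh : (j : ↥(Finset.Iic n)) → E => hh ⟨n, Finset.mem_Iic.2 le_rfl⟩)
          (measurable_pi_apply _))) = ((ν₀ univ)⁻¹ * ν₁ univ).toReal := by
  haveI := isProbabilityMeasure_fwdPathLaw ν₀ h0 κF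
  exact h.integral_sampleMean_exp_neg_work_of_stationary h0
    (h.measurePreserving_shift_restartChain K h0 hK) (h.restartChain_map_eval K h0 hK 0) hn

/-- **Strong consistency along an ERGODIC restart chain**: if the equilibrium restart chain of
forward records is ergodic for the shift (a property of the level sampler `K`, assumed), then
`ΔF̂_n → ΔF` almost surely along it. -/
theorem tendsto_jarzynskiEstimate_ae_restartChain (K : Kernel Ω Ω) [IsMarkovKernel K]
    [IsFiniteMeasure ν₀] [IsFiniteMeasure ν₁] [IsMarkovKernel κF] [IsMarkovKernel κR]
    (h0 : ν₀ univ ≠ 0) (hK : Kernel.Invariant K ν₀) (h : CrooksPair ν₀ ν₁ κF κR s e W) {ΔF : ℝ}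
    (hΔF : Real.exp (-ΔF) = ((ν₀ univ)⁻¹ * ν₁ univ).toReal)
    (hErg : haveI := isProbabilityMeasure_fwdPathLaw ν₀ h0 κF
      Ergodic (fun (x : ℕ → E) (k : ℕ) => x (k + 1))
        (Kernel.trajMeasure (X := fun _ : ℕ => E) (fwdPathLaw ν₀ κF)
          (fun n : ℕ => ((κF ∘ₖ K).comap s h.measurable_s).comap
            (fun hh : (j : ↥(Finset.Iic n)) → E => hh ⟨n, Finset.mem_Iic.2 le_rfl⟩)
            (measurable_pi_apply _)))) :
    haveI := isProbabilityMeasure_fwdPathLaw ν₀ h0 κF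
    ∀ᵐ x ∂(Kernel.trajMeasure (X := fun _ : ℕ => E) (fwdPathLaw ν₀ κF)
        (fun n : ℕ => ((κF ∘ₖ K).comap s h.measurable_s).comap
          (fun hh : (j : ↥(Finset.Iic n)) → E => hh ⟨n, Finset.mem_Iic.2 le_rfl⟩)
          (measurable_pi_apply _))),
      Tendsto (fun n : ℕ => jarzynskiEstimate (fun ε => Real.exp (-W ε)) (fun i : Fin n => x i))
        atTop (𝓝 ΔF) := by
  haveI := isProbabilityMeasure_fwdPathLaw ν₀ h0 κF
  exact h.tendsto_jarzynskiEstimate_ae_of_ergodic h0 hΔF hErg (h.restartChain_map_eval K h0 hK 0)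

end CrooksPair

end Summit.Ventures.LatticeQCDFlow.Exactness.GeneralNCMC
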